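import Mathlib
import Literature.NumberTheory.EllipticCurves.TateModuleCharpolyOfDegree
import HarnessLib

/-!
# Roots of unity in `\overline{ℚ_p}` keep their distance: `|ζ - 1|_p ≥ |p|_p`, and
# `∏_{ζ^r = 1} |β - ζ|_p ≥ c_β |r|_p` for `β` not a root of unity

Topic `NumberTheory/LFunctions` (used for the `p`-adic size of the resultants `Res(P, X^r - 1)`,
i.e. of the point counts `#A(𝔽_{q^r})`, in `FrobeniusCharpolyOfPointCounts`); **proof file**, theorems
only (D-0014/D-0026).

* `norm_p_le_of_one_add_pow_prime_pow_eq_one` — if `(1 + y)^{p^k} = 1` and `y ≠ 0` then `|y| ≥ |p|`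
  (a weak form of `|ζ_{p^k} - 1| = |p|^{1/φ(p^k)}`): for `|y| < |p|` one has `|(1+y)^p - 1| = |p| |y|`
  exactly (`(1+y)^p - 1 = y (p + y·w)`, `|w| ≤ 1`), so the `p`-th power map never reaches `1`;
* `eq_zero_of_one_add_pow_eq_one` — if `(1 + y)^m = 1`, `p ∤ m`, `|y| < 1`, then `y = 0`;
* `norm_p_le_norm_sub_one` — **every root of unity `η ≠ 1` has `|η - 1| ≥ |p|`**;
* `eq_of_norm_sub_lt_norm_p` — two roots of unity within `|p|` of the same point coincide;
* `exists_pos_le_norm_sub` — for `β` not a root of unity there is `c_β > 0` below all `|β - ζ|`;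
* `mul_norm_natCast_le_prod_norm_sub` — **`c_β · |r| ≤ ∏_{ζ^r = 1} |β - ζ|`**: all `r`-th roots of
  unity but the one closest to `β` are at least as far from `β` as from that one, and
  `∏_{ζ ≠ ζ₀} (ζ₀ - ζ) = (X^r - 1)'(ζ₀) = r ζ₀^{r-1}`;
* `inv_natCast_le_norm_natCast` — `|r|_p ≥ 1/r`.

## References

Standard `p`-adic analysis (e.g. the distances between roots of unity); no specific source is followed.
[folklore]

## Design

Mathlib (pin, used): `PadicAlgCl` with `PadicAlgCl.norm_extends`, `IsUltrametricDist.norm_add_le_max`,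
`IsUltrametricDist.norm_add_eq_max_of_norm_ne_norm`, `geom_sum_mul`, `Polynomial.nthRoots`,
`Polynomial.eval_multiset_prod_X_sub_C_derivative`, `prod_multiset_X_sub_C_of_monic_of_roots_card_eq`,
`Nat.exists_eq_pow_mul_and_not_dvd`, `pow_padicValNat_dvd`.  In the tree (used):
`TateModule.norm_intCast_padic_eq`.
-/

noncomputable section

open Polynomial Finset
open scoped Classical

namespace Literature.NumberTheory.LFunctions

namespace PadicRootsOfUnity

variable {p : ℕ} [hp : Fact p.Prime]

/-! ### Norm bookkeeping in `\overline{ℚ_p}` -/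

/-- The ultrametric inequality for differences. [folklore] -/
private theorem norm_sub_le_max' (a b : PadicAlgCl p) : ‖a - b‖ ≤ max ‖a‖ ‖b‖ := by
  rw [sub_eq_add_neg, ← norm_neg b]
  exact IsUltrametricDist.norm_add_le_max a (-b)

/-- `|p| = p⁻¹` in `\overline{ℚ_p}`. [folklore] -/
private theorem norm_p : ‖(p : PadicAlgCl p)‖ = (p : ℝ)⁻¹ := by
  rw [← map_natCast (algebraMap ℚ_[p] (PadicAlgCl p)) p]
  change ‖((p : ℚ_[p]) : PadicAlgCl p)‖ = _
  rw [PadicAlgCl.norm_extends p, Padic.norm_p]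

/-- `0 < |p| < 1`. [folklore] -/
theorem norm_p_pos : 0 < ‖(p : PadicAlgCl p)‖ := by
  rw [norm_p]; exact inv_pos.2 (by exact_mod_cast hp.out.pos)

/-- `|p| < 1`. [folklore] -/
private theorem norm_p_lt_one : ‖(p : PadicAlgCl p)‖ < 1 := by
  rw [norm_p]; exact inv_lt_one_of_one_lt₀ (by exact_mod_cast hp.out.one_lt)

/-- `|n| ≤ 1` for a natural number `n`. [folklore] -/
theorem norm_natCast_le_one (n : ℕ) : ‖(n : PadicAlgCl p)‖ ≤ 1 := by
  rw [← map_natCast (algebraMap ℚ_[p] (PadicAlgCl p)) n]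
  change ‖((n : ℚ_[p]) : PadicAlgCl p)‖ ≤ 1
  rw [PadicAlgCl.norm_extends p]
  exact_mod_cast Padic.norm_int_le_one (n : ℤ)

/-- `|m| = 1` for `m` prime to `p`. [folklore] -/
private theorem norm_natCast_eq_one_of_not_dvd {m : ℕ} (hm : ¬ p ∣ m) : ‖(m : PadicAlgCl p)‖ = 1 := by
  rw [← map_natCast (algebraMap ℚ_[p] (PadicAlgCl p)) m]
  change ‖((m : ℚ_[p]) : PadicAlgCl p)‖ = 1
  rw [PadicAlgCl.norm_extends p]
  refine le_antisymm (by exact_mod_cast Padic.norm_int_le_one (m : ℤ)) ?_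
  by_contra hlt
  have h : ‖((m : ℤ) : ℚ_[p])‖ < 1 := by push_cast; exact not_le.mp hlt
  rw [Padic.norm_intCast_lt_one_iff] at h
  exact hm (by exact_mod_cast h)

/-- `|r|_p ≥ 1/r` for `r ≥ 1`. [folklore] -/
theorem inv_natCast_le_norm_natCast {r : ℕ} (hr : 0 < r) : (r : ℝ)⁻¹ ≤ ‖(r : PadicAlgCl p)‖ := by
  rw [← map_natCast (algebraMap ℚ_[p] (PadicAlgCl p)) r]
  change (r : ℝ)⁻¹ ≤ ‖((r : ℚ_[p]) : PadicAlgCl p)‖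
  rw [PadicAlgCl.norm_extends p]
  have h := EllipticCurves.TateModule.norm_intCast_padic_eq (p := p) (z := (r : ℤ)) (by exact_mod_cast hr.ne')
  push_cast at h
  rw [h]
  refine inv_anti₀ (pow_pos (by exact_mod_cast hp.out.pos) _) ?_
  rw [padicValInt.of_nat]
  exact_mod_cast Nat.le_of_dvd hr pow_padicValNat_dvd

/-- A root of unity has norm `1`. [folklore] -/
theorem norm_eq_one_of_pow_eq_one {η : PadicAlgCl p} {n : ℕ} (hn : 0 < n) (h : η ^ n = 1) : ‖η‖ = 1 := by
  have h1 : ‖η‖ ^ n = 1 := by rw [← norm_pow, h, norm_one]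
  exact (pow_eq_one_iff_of_nonneg (norm_nonneg _) hn.ne').mp h1

/-- Geometric sums of elements of norm `≤ 1` have norm `≤ 1`. [folklore] -/
theorem norm_geom_sum_le_one {x : PadicAlgCl p} (hx : ‖x‖ ≤ 1) (n : ℕ) :
    ‖∑ i ∈ range n, x ^ i‖ ≤ 1 := by
  refine IsUltrametricDist.norm_sum_le_of_forall_le_of_nonneg zero_le_one fun i _ => ?_
  rw [norm_pow]
  exact pow_le_one₀ (norm_nonneg _) hx

/-- **`(1 + y)^n - 1 = y · (n + y · w)` with `|w| ≤ 1`** (for `|y| ≤ 1`): the binomial expansion to first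
order, through geometric sums. [folklore] -/
theorem exists_one_add_pow_sub_one_eq {y : PadicAlgCl p} (hy : ‖y‖ ≤ 1) (n : ℕ) :
    ∃ w : PadicAlgCl p, ‖w‖ ≤ 1 ∧ (1 + y) ^ n - 1 = y * (n + y * w) := by
  refine ⟨∑ i ∈ range n, ∑ j ∈ range i, (1 + y) ^ j, ?_, ?_⟩
  · refine IsUltrametricDist.norm_sum_le_of_forall_le_of_nonneg zero_le_one fun i _ => ?_
    refine norm_geom_sum_le_one ?_ i
    calc ‖1 + y‖ ≤ max ‖(1 : PadicAlgCl p)‖ ‖y‖ := IsUltrametricDist.norm_add_le_max _ _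
      _ ≤ 1 := max_le (by rw [norm_one]) hy
  · have h1 : (1 + y) ^ n - 1 = y * ∑ i ∈ range n, (1 + y) ^ i := by
      rw [mul_comm, ← geom_sum_mul (1 + y) n, add_sub_cancel_left]
    have h2 : ∀ i, (1 + y) ^ i = 1 + y * ∑ j ∈ range i, (1 + y) ^ j := fun i => by
      have h := geom_sum_mul (1 + y) i
      rw [add_sub_cancel_left] at h
      linear_combination -h
    rw [h1]
    congr 1
    have h3 : ∑ i ∈ range n, (1 + y) ^ i = ∑ i ∈ range n, (1 + y * ∑ j ∈ range i, (1 + y) ^ j) :=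
      Finset.sum_congr rfl fun i _ => h2 i
    rw [h3, Finset.sum_add_distrib, Finset.sum_const, Finset.card_range, Nat.smul_one_eq_cast,
      Finset.mul_sum]

/-! ### Roots of unity stay away from `1` -/

/-- **Prime-to-`p` roots of unity do not approach `1`**: if `(1 + y)^m = 1` with `p ∤ m` and `|y| < 1`,
then `y = 0`. [folklore] -/
theorem eq_zero_of_one_add_pow_eq_one {y : PadicAlgCl p} {m : ℕ} (hm : ¬ p ∣ m) (hy : ‖y‖ < 1)
    (h : (1 + y) ^ m = 1) : y = 0 := by
  obtain ⟨w, hw, hid⟩ := exists_one_add_pow_sub_one_eq hy.le m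
  rw [h, sub_self] at hid
  have hne : (m : PadicAlgCl p) + y * w ≠ 0 := by
    intro h0
    have h1 : ‖(m : PadicAlgCl p)‖ = ‖y * w‖ := by
      rw [eq_neg_of_add_eq_zero_left h0, norm_neg]
    rw [norm_natCast_eq_one_of_not_dvd hm, norm_mul] at h1
    have : ‖y‖ * ‖w‖ < 1 := by
      calc ‖y‖ * ‖w‖ ≤ ‖y‖ * 1 := mul_le_mul_of_nonneg_left hw (norm_nonneg _)
        _ < 1 := by rw [mul_one]; exact hy
    exact absurd h1 this.ne'
  exact (mul_eq_zero.mp hid.symm).resolve_right hne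

/-- **`p`-power roots of unity do not approach `1` closer than `|p|`**: if `(1 + y)^{p^k} = 1` and `y ≠ 0`
then `|p| ≤ |y|`.  (For `|y| < |p|`, `|(1+y)^p - 1| = |p| |y| < |p|` is again nonzero and small.)
[folklore] -/
theorem norm_p_le_of_one_add_pow_prime_pow_eq_one {k : ℕ} :
    ∀ {y : PadicAlgCl p}, y ≠ 0 → (1 + y) ^ p ^ k = 1 → ‖(p : PadicAlgCl p)‖ ≤ ‖y‖ := by
  induction k with
  | zero =>
    intro y hy0 h
    rw [pow_zero, pow_one, add_eq_left] at h
    exact absurd h hy0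
  | succ k ih =>
    intro y hy0 h
    by_contra hlt
    rw [not_le] at hlt
    have hy1 : ‖y‖ < 1 := hlt.trans norm_p_lt_one
    -- `z = (1+y)^p - 1 = y (p + y w)` has norm `|p| |y|`
    obtain ⟨w, hw, hid⟩ := exists_one_add_pow_sub_one_eq hy1.le p
    set z := (1 + y) ^ p - 1 with hz
    have hyw : ‖y * w‖ < ‖(p : PadicAlgCl p)‖ := by
      rw [norm_mul]
      calc ‖y‖ * ‖w‖ ≤ ‖y‖ * 1 := mul_le_mul_of_nonneg_left hw (norm_nonneg _)
        _ < ‖(p : PadicAlgCl p)‖ := by rw [mul_one]; exact hlt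
    have hsum : ‖(p : PadicAlgCl p) + y * w‖ = ‖(p : PadicAlgCl p)‖ := by
      rw [IsUltrametricDist.norm_add_eq_max_of_norm_ne_norm hyw.ne', max_eq_left hyw.le]
    have hzn : ‖z‖ = ‖y‖ * ‖(p : PadicAlgCl p)‖ := by rw [hid, norm_mul, hsum]
    have hz0 : z ≠ 0 := by
      rw [← norm_pos_iff, hzn]; exact mul_pos (norm_pos_iff.2 hy0) norm_p_pos
    have hzk : (1 + z) ^ p ^ k = 1 := by
      rw [hz, add_sub_cancel, ← pow_mul, ← pow_succ']; exact h
    have hle := ih hz0 hzk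
    rw [hzn] at hle
    have : ‖y‖ * ‖(p : PadicAlgCl p)‖ < ‖(p : PadicAlgCl p)‖ := by
      calc ‖y‖ * ‖(p : PadicAlgCl p)‖ < 1 * ‖(p : PadicAlgCl p)‖ := mul_lt_mul_of_pos_right hy1 norm_p_pos
        _ = _ := one_mul _
    exact absurd hle (not_le.mpr this)

/-- **Every root of unity `η ≠ 1` satisfies `|η - 1| ≥ |p|`.** Write the order as `p^k m`, `p ∤ m`:
`η^{p^k}` is a prime-to-`p` root of unity close to `1`, hence `= 1`, and then the `p`-power case applies.
[folklore] -/
theorem norm_p_le_norm_sub_one {η : PadicAlgCl p} {n : ℕ} (hn : 0 < n) (h : η ^ n = 1) (h1 : η ≠ 1) :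
    ‖(p : PadicAlgCl p)‖ ≤ ‖η - 1‖ := by
  by_cases hlt : ‖η - 1‖ < 1
  swap
  · exact norm_p_lt_one.le.trans (not_lt.mp hlt)
  obtain ⟨k, m, hm, hnk⟩ := Nat.exists_eq_pow_mul_and_not_dvd hn.ne' p hp.out.ne_one
  have hη1 : ‖η‖ = 1 := norm_eq_one_of_pow_eq_one hn h
  set y := η - 1 with hy
  have hηy : η = 1 + y := by rw [hy, add_sub_cancel]
  -- `θ = η^{p^k}` is a prime-to-`p` root of unity with `|θ - 1| < 1`, hence `θ = 1`
  have hθm : (1 + (η ^ p ^ k - 1)) ^ m = 1 := by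
    rw [add_sub_cancel, ← pow_mul, ← hnk, h]
  have hθ1 : ‖η ^ p ^ k - 1‖ < 1 := by
    obtain ⟨w, hw, hid⟩ := exists_one_add_pow_sub_one_eq (y := y) (by rw [hy]; exact hlt.le) (p ^ k)
    rw [hηy, hid, norm_mul]
    have hb : ‖((p ^ k : ℕ) : PadicAlgCl p) + y * w‖ ≤ 1 := by
      refine (IsUltrametricDist.norm_add_le_max _ _).trans (max_le ?_ ?_)
      · exact norm_natCast_le_one (p := p) (p ^ k)
      · rw [norm_mul]
        exact mul_le_one₀ (by rw [hy]; exact hlt.le) (norm_nonneg _) hw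
    calc ‖y‖ * ‖((p ^ k : ℕ) : PadicAlgCl p) + y * w‖ ≤ ‖y‖ * 1 :=
          mul_le_mul_of_nonneg_left hb (norm_nonneg _)
      _ < 1 := by rw [mul_one, hy]; exact hlt
  have hθ : η ^ p ^ k - 1 = 0 := eq_zero_of_one_add_pow_eq_one hm hθ1 hθm
  have hk : (1 + y) ^ p ^ k = 1 := by rw [← hηy]; exact sub_eq_zero.mp hθ
  exact norm_p_le_of_one_add_pow_prime_pow_eq_one (sub_ne_zero.mpr h1) hk

/-- **Two roots of unity within `|p|` of the same point coincide.** [folklore] -/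
theorem eq_of_norm_sub_lt_norm_p {ζ ζ' β : PadicAlgCl p} {n n' : ℕ} (hn : 0 < n) (hζ : ζ ^ n = 1)
    (hn' : 0 < n') (hζ' : ζ' ^ n' = 1) (h : ‖β - ζ‖ < ‖(p : PadicAlgCl p)‖)
    (h' : ‖β - ζ'‖ < ‖(p : PadicAlgCl p)‖) : ζ = ζ' := by
  have hζ'1 : ‖ζ'‖ = 1 := norm_eq_one_of_pow_eq_one hn' hζ'
  have hζ'0 : ζ' ≠ 0 := norm_pos_iff.mp (by rw [hζ'1]; exact one_pos)
  set η := ζ * ζ'⁻¹ with hη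
  have hηn : η ^ (n * n') = 1 := by
    rw [hη, mul_pow, pow_mul, hζ, one_pow, one_mul, mul_comm, pow_mul, inv_pow, hζ', inv_one, one_pow]
  have hdist : ‖ζ - ζ'‖ < ‖(p : PadicAlgCl p)‖ := by
    have : ζ - ζ' = (β - ζ') - (β - ζ) := by ring
    rw [this]
    exact (norm_sub_le_max' _ _).trans_lt (max_lt h' h)
  have hη1 : ‖η - 1‖ = ‖ζ - ζ'‖ := by
    have : η - 1 = (ζ - ζ') * ζ'⁻¹ := by
      rw [hη, sub_mul, mul_inv_cancel₀ hζ'0]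
    rw [this, norm_mul, norm_inv, hζ'1, inv_one, mul_one]
  by_contra hne
  have hne1 : η ≠ 1 := by
    intro h1
    apply hne
    rw [hη] at h1
    calc ζ = ζ * ζ'⁻¹ * ζ' := by rw [mul_assoc, inv_mul_cancel₀ hζ'0, mul_one]
      _ = ζ' := by rw [h1, one_mul]
  have hle := norm_p_le_norm_sub_one (Nat.mul_pos hn hn') hηn hne1
  rw [hη1] at hle
  exact absurd hle (not_le.mpr hdist)

/-- **A point which is not a root of unity keeps a positive distance from all roots of unity**: at most one
root of unity lies within `|p|` of `β` (`eq_of_norm_sub_lt_norm_p`), and it is not `β`. [folklore] -/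
theorem exists_pos_le_norm_sub {β : PadicAlgCl p} (hβ : ∀ n : ℕ, 0 < n → β ^ n ≠ 1) :
    ∃ c : ℝ, 0 < c ∧ ∀ (ζ : PadicAlgCl p) (n : ℕ), 0 < n → ζ ^ n = 1 → c ≤ ‖β - ζ‖ := by
  by_cases hex : ∃ (ζ : PadicAlgCl p) (n : ℕ), 0 < n ∧ ζ ^ n = 1 ∧ ‖β - ζ‖ < ‖(p : PadicAlgCl p)‖
  · obtain ⟨ζ₁, n₁, hn₁, hζ₁, hlt₁⟩ := hex
    have hc : 0 < ‖β - ζ₁‖ := by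
      rw [norm_pos_iff, sub_ne_zero]
      rintro rfl
      exact hβ n₁ hn₁ hζ₁
    refine ⟨‖β - ζ₁‖, hc, fun ζ n hn hζ => ?_⟩
    by_cases hlt : ‖β - ζ‖ < ‖(p : PadicAlgCl p)‖
    · rw [eq_of_norm_sub_lt_norm_p hn hζ hn₁ hζ₁ hlt hlt₁]
    · exact hlt₁.le.trans (not_lt.mp hlt)
  · push Not at hex
    exact ⟨‖(p : PadicAlgCl p)‖, norm_p_pos, fun ζ n hn hζ => hex ζ n hn hζ⟩

/-! ### The product over the `r`-th roots of unity -/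

/-- The `r`-th roots of unity in `\overline{ℚ_p}`: `∏_{ζ^r = 1} (X - ζ) = X^r - 1`, the product over
`nthRoots r 1` with multiplicity. [folklore] -/
theorem prod_nthRoots_X_sub_C {r : ℕ} (hr : 0 < r) :
    ((nthRoots r (1 : PadicAlgCl p)).map fun ζ => X - C ζ).prod = X ^ r - 1 := by
  have hmon : (X ^ r - C (1 : PadicAlgCl p)).Monic := monic_X_pow_sub_C 1 hr.ne'
  have hcard : Multiset.card (X ^ r - C (1 : PadicAlgCl p)).roots = (X ^ r - C (1 : PadicAlgCl p)).natDegree := by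
    rw [← (IsAlgClosed.splits (X ^ r - C (1 : PadicAlgCl p))).natDegree_eq_card_roots]
  have h := prod_multiset_X_sub_C_of_monic_of_roots_card_eq hmon hcard
  rw [nthRoots, h, C_1]

/-- **`c_β · |r| ≤ ∏_{ζ^r = 1} |β - ζ|`.**  If `c ≤ |β - ζ|` for all roots of unity `ζ`, then for `r ≥ 1` the
product of the distances from `β` to the `r`-th roots of unity (with multiplicity, i.e. over `nthRoots r 1`) is
at least `c |r|_p`: for the closest one, `ζ₀`, the factor is `≥ c`; every other `ζ` has
`|β - ζ| ≥ |ζ₀ - ζ|` (ultrametric inequality), and `∏_{ζ ≠ ζ₀} (ζ₀ - ζ) = (X^r - 1)'(ζ₀) = r ζ₀^{r-1}`.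
[folklore] -/
theorem mul_norm_natCast_le_prod_norm_sub {β : PadicAlgCl p} {c : ℝ}
    (hc : ∀ (ζ : PadicAlgCl p) (n : ℕ), 0 < n → ζ ^ n = 1 → c ≤ ‖β - ζ‖) {r : ℕ} (hr : 0 < r) :
    c * ‖(r : PadicAlgCl p)‖ ≤ ((nthRoots r (1 : PadicAlgCl p)).map fun ζ => ‖β - ζ‖).prod := by
  set S := nthRoots r (1 : PadicAlgCl p) with hS
  have hmemS : ∀ ζ ∈ S, ζ ^ r = 1 := fun ζ hζ => (mem_nthRoots hr).mp hζ
  have h1S : (1 : PadicAlgCl p) ∈ S := (mem_nthRoots hr).mpr (one_pow r)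
  -- the closest root of unity
  obtain ⟨ζ₀, hζ₀S, hmin⟩ := Finset.exists_min_image S.toFinset (fun ζ => ‖β - ζ‖)
    ⟨1, Multiset.mem_toFinset.mpr h1S⟩
  have hζ₀ : ζ₀ ∈ S := Multiset.mem_toFinset.mp hζ₀S
  have hζ₀1 : ‖ζ₀‖ = 1 := norm_eq_one_of_pow_eq_one hr (hmemS ζ₀ hζ₀)
  -- split off `ζ₀`
  rw [← Multiset.cons_erase hζ₀, Multiset.map_cons, Multiset.prod_cons]
  -- the other factors dominate `|ζ₀ - ζ|`
  have hle : ((S.erase ζ₀).map fun ζ => ‖ζ₀ - ζ‖).prod ≤ ((S.erase ζ₀).map fun ζ => ‖β - ζ‖).prod := by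
    refine Multiset.prod_map_le_prod_map₀ _ _ (fun ζ _ => norm_nonneg _) fun ζ hζ => ?_
    have hζS : ζ ∈ S := Multiset.mem_of_mem_erase hζ
    have hmin' : ‖β - ζ₀‖ ≤ ‖β - ζ‖ := hmin ζ (Multiset.mem_toFinset.mpr hζS)
    have : ζ₀ - ζ = (β - ζ) - (β - ζ₀) := by ring
    rw [this]
    exact (norm_sub_le_max' _ _).trans (max_le le_rfl hmin')
  -- `∏_{ζ ≠ ζ₀} (ζ₀ - ζ) = r ζ₀^{r-1}`
  have hder : ((S.erase ζ₀).map fun ζ => ζ₀ - ζ).prod = (r : PadicAlgCl p) * ζ₀ ^ (r - 1) := by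
    rw [← eval_multiset_prod_X_sub_C_derivative hζ₀, hS, prod_nthRoots_X_sub_C hr, derivative_sub,
      derivative_X_pow, derivative_one, sub_zero, eval_mul, eval_C, eval_pow, eval_X]
  have hnorm : ((S.erase ζ₀).map fun ζ => ‖ζ₀ - ζ‖).prod = ‖(r : PadicAlgCl p)‖ := by
    have h : ‖((S.erase ζ₀).map fun ζ => ζ₀ - ζ).prod‖ = ‖(r : PadicAlgCl p)‖ := by
      rw [hder, norm_mul, norm_pow, hζ₀1, one_pow, mul_one]
    rw [← h]
    change _ = (normHom : PadicAlgCl p →*₀ ℝ) _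
    rw [map_multiset_prod, Multiset.map_map]
    rfl
  have hprod0 : 0 ≤ ((S.erase ζ₀).map fun ζ => ‖β - ζ‖).prod :=
    Multiset.prod_nonneg fun x hx => by
      obtain ⟨ζ, -, rfl⟩ := Multiset.mem_map.mp hx
      exact norm_nonneg _
  calc c * ‖(r : PadicAlgCl p)‖ = c * ((S.erase ζ₀).map fun ζ => ‖ζ₀ - ζ‖).prod := by rw [hnorm]
    _ ≤ ‖β - ζ₀‖ * ((S.erase ζ₀).map fun ζ => ‖β - ζ‖).prod :=
        mul_le_mul (hc ζ₀ r hr (hmemS ζ₀ hζ₀)) hle (hnorm ▸ norm_nonneg _) (norm_nonneg _)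

end PadicRootsOfUnity

end Literature.NumberTheory.LFunctions

end
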